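import Summits.ResolutionOfSingularities.ResolutionOfSingularities.Theorems.RiderCutClasses
import Summits.ResolutionOfSingularities.ResolutionOfSingularities.Theorems.AbsoluteGiraudBranch
import HarnessLib

/-!
# TameCutClasses — decomp-res node «TameCut» (lens-4 g21) refining the MaxContactCut aside 32260; tree file 1/3 of the node

Content VERBATIM from the decomp-res lens-4 g21 file `HOME/decomp-res-lens-4/g21/TameCut.lean` (sha256 ad77f9303f4ee357 ≡
`parts/TameCut-NODE-ad77f930.lean`, 786 l, written directly against the tree: no copy of earlier generations).  HOME =
run/shared/lean/pub/decomp-res.  Critic: CRITIC-LEDGER row 134 CLEARED, landing order 2026-08-30T19:16:20Z.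

Route-independent, OUTSIDE the Theses cone (importable by the route file for asides): §43 the WEIGHT / ROOT-RESIDUE
AXIS of every tower
class (`NoTowerWild` p ∣ n · `NoTowerTameSep` p ∤ n, separable root · `NoTowerTameInsep` p ∤ n, inseparable
root · perfect-field
variants; EXACT `noTower_iff_g21`, monotonicity, `noTowerTameInsep_of_imperfect`), §45 the cells cut on the lens-4
column at weight
`n` (`WildOffLocusTowersTerminate` = THE LOCATED RESIDUAL of (O), `TameSep…`/`TameInsep…`/`TamePerfect…` off-locus and
non-principal in-locus cells, the 31572 cells), §46 the all-weights classes (`NoWildOffLocusTowers` …), §47 the Lucas bite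
(`choose_sub_one_eq`, `exists_not_dvd_of_not_dvd_sum`, `not_dvd_of_lt`).  Kernels: `TameCutKernels`.

[WRITER NOTE (decomp-res writer g6): namespace `…Theorems.HugValuationCut` as the whole lens-4 chain; split by the
critic's order into
`TameCutClasses` (cone-free: §43 axes, §45 cell classes, §46 all-weights classes, §47 arithmetic certificate —
the g20 arithmetic
file the critic names for §47 is not in the tree yet), `TameCutKernels` (cone-free: §44 the tame contact theorem +
the §45 kernels /
EXACT re-locations at weight `n`) and `MaxContactCutTameCut` (inside the Theses cone: §46 BY-NAME wiring).  Nothing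
else changed.]

## The lens's node description (VERBATIM)

# TameCut — decomp-res lens-4 («minimal-counterexample / extremal reduction»), generation 21

HOST TARGET BY NAME: `MaxContactCut.NoSingularSurfaceHuggingTowers` (item 32260); ROOT `MaxContactCut.NoForcedTowers`
(30253); up-links 32203 `NoSurfaceHuggingTowers`, 31570 `NoHuggingTowers`; the orthogonal leaves 31571
`NoContactHuggingTowers` and 31572 `NoWildHuggingTowers` are CUT BY NAME as well.  Lineage: g14 HugValuationCut …
g19 RiderCut (tree `Theorems/HugValuationCut*`, `MarkingBudget*`, `WeightDescent*`, `FactorContact*`, `CouplingCut*`,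
`RiderCut*`, wiring `MaxContactCut<Node>`), g20 AbsoluteRider (HOME only).  This file extends the tree's g19 state
(`singularSurface_iff_g19`, `noForcedTowers_iff_g19`): after g19/g20 the open mass of the lens-4 column is
(O) `OffLocusShadowTowersTerminate` and (L,¬P) `NonPrincipalInLocusTowersTerminate` (g20 closed the impure principal
column over every field modulo `AbsRiderPort`; not yet in the tree, so the g19 imperfect residual
`IncommensurableWildDriftingImperfectTowersTerminate` is carried VERBATIM as a conjunct here).

## THE EXTREMAL OBJECT OF g21: THE WEIGHT OF A MINIMAL COUNTEREXAMPLE, READ AGAINST THE CHARACTERISTIC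

A minimal infinite forced tower has a WEIGHT `n` (the marking, constant along the tower: `tower_mult_eq`) and a ROOT
POINT `x₀` with residue field `κ(x₀) ⊇ k`.  The new axis is the pair (is `p ∣ n`?, is `κ(x₀)/k` separable?) —
port-free, decidable-by-`em` splits of EVERY tower class `NoTower n P`:

  `NoTower n P ⟺ NoTowerWild n P [p ∣ n] ∧ NoTowerTameSep n P [p ∤ n, κ(x₀)/k separable] ∧ NoTowerTameInsep n P
   [p ∤ n, κ(x₀)/k inseparable — an IMPERFECT-field phenomenon: `noTowerTameInsep_of_imperfect`]`   (`noTower_iff_g21`).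

## THE TAME CONTACT THEOREM (§44 · KERNEL · hypothesis-free · standard axioms · NO PORT)

  `contactHugging_of_tame_sep`:  a forced tower over `(k, char p)` with `IsBase` root, `IsDatum n`, `p ∤ n` and SEPARABLE
  residue field at the root point is a CONTACT tower (`ContactHugging T`: a regular hypersurface germ through `x₀` is
  hugged for ever).  Over a PERFECT field the separability binder is automatic (`contactHugging_of_tame_perfect`).

Proof (all in kernel, assembled from TREE theorems): (T1) `ord_{x₀} I₀ = n` (`IsDatum` + isolated support point), so
some `h ∈ I₀,x₀` has `h ∈ 𝔪^n ∖ 𝔪^{n+1}`; (T2) THE TAME HASSE LEMMA = the tree's PROVED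
`AbsoluteContactClasses.hsPortSepResidue` (lens-6 g16; Stacks 00TV + EGA IV 16.11.2: at a regular point with
separable residue field a `k`-linear differential operator `D` of order `≤ n − 1` has `ord D h = 1` as soon as
`p ∤ n` — the Lucas/Euler bite `∂^{(β−e_i)} X^β = β_i X_i`, `Σ β_i = n ≢ 0 (mod p)`); restriction of scalars
(`diffIdeal_restrict_le`) makes `u = D h ∈ Diff^{≤n−1}_ℤ(I₀,x₀) ∩ (𝔪 ∖ 𝔪²)` an ABSOLUTE contact element
(`isAbsContactAt_of_tame_sep`); (T3) spread `(u)` to an ideal sheaf `H ∋ x₀` (tree `CentreSpread.centreSpread`);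
(T4) GIRAUD PERSISTENCE ALONG THE FORCED TOWER (`tower_absInv_strictIter`): every stage is locally Noetherian and
regular (tree `IsBlowup.isLocallyNoetherian`, `IsBlowup.isRegular_of_isRegular_subscheme`, by induction from the
root base: `tower_isLocallyNoetherian_isRegular`), the weight is constant and `I_j,x_j ⊆ 𝔪^n` at every stage
(`tower_stalkIdeal_le_pow`), so the tree's scheme-level point round `AbsoluteContactClasses.absInv_point`
(Giraud's lemma over `ℤ` + the chart computation, lens-6 g16, any marking) iterates: the strict transform of `H` is
a regular hypersurface germ `(z_j)`, `z_j ∈ Diff^{≤n−1}_ℤ(I_j) ∩ (𝔪 ∖ 𝔪²)`, through EVERY `x_j`; (T5) hence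
`HugsGerm T 0 H` with `ord_{x₀} H = 1`: `ContactHugging T`.

## CONSEQUENCES (§45–§46): the TAME–SEPARABLE SLAB OF THE WHOLE lens-4 COLUMN IS A CONTACT SLAB

* `noTowerTameSep_of_contact`: `ContactHuggingTowersTerminate n → NoTowerTameSep n P` for EVERY class `P` — the
  tame-separable slabs of (O) and (L,¬P) are RE-BOOKED BY NAME on 31571 by a KERNEL theorem (no port):
  `tameSepOffLocus_of_contact`, `tameSepNonPrincipal_of_contact`, all weights `noTameSepOffLocusTowers_of_item`,
  `noTameSepNonPrincipalInLocusTowers_of_item`.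
* OVER PERFECT FIELDS THE TAME SLAB IS EMPTY-MOD-PORT(KNOWN): `noTowerTamePerfect_of_ports` — the tree's
  `MaxContactCutContactShadow.contactPerfect_of_ports` (lens-4 g12, critic row 76: ports `ContactShadow n`,
  `TowerObstructsAll` and X1 = `MaxContactCut.MarkedThreefoldResolution` 28616, KNOWN-MOD-PORT Cutkosky2009 5.1)
  composed with the tame contact theorem: `tamePerfectOffLocus_of_ports`, `tamePerfectNonPrincipal_of_ports`.
  THIS IS THE DECIDED CELL OF g21: (O, p ∤ n, perfect k) and (L,¬P, p ∤ n, perfect k) are EMPTY modulo KNOWN ports,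
  by a KERNEL LAW, with CENSUS INHABITANTS (below).
* THE WILD LEAF 31572 hypothesis-free: `wildHugging_iff_g21 : WildHuggingTowersTerminate n ⟺ NoTowerWild n W ∧
  NoTowerTameInsep n W` («KANGAROOS ARE WILD»: an infinite tower hugging a germ but no regular hypersurface germ has
  `p ∣ n` or an inseparable root) — all weights `noWildHuggingTowers_iff_g21` (31572 BY NAME, no hypothesis).
* EXACT RE-LOCATIONS (given 31571 at the weight, resp. BY NAME): `offLocus_iff_g21`, `nonPrincipal_iff_g21`,
  `singularSurface_iff_g21`, `ftt_step_of_g21`; all weights `noOffLocusShadowTowers_iff_g21`,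
  `noNonPrincipalInLocusTowers_iff_g21`, `noSingularSurfaceHuggingTowers_iff_g21` (GIVEN 31571),
  `noSingularSurfaceHuggingTowers_iff_g21'` (g19's hypothesis list EXACTLY, the tame-separable slabs as explicit
  conjuncts certified `⊆ 31571` by `…_of_item`), `noForcedTowers_iff_g21` (31571 as a booked conjunct of the root,
  g19's hypothesis list EXACTLY), up-links `noSurfaceHuggingTowers_of_g21`, `noHuggingTowers_of_g21`.

## THE g21 EXACT STATEMENT (tree g19 ports; `⟦…⟧` = booked BY NAME elsewhere)

  32260 ⟺ ⟦31571-slabs: NoTameSepOffLocusTowers ∧ NoTameSepNonPrincipalInLocusTowers⟧ ∧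
NoWildOffLocusTowers (O, p ∣ n)
        ∧ NoTameInsepOffLocusTowers (O, p ∤ n, insep root · imperfect k) ∧ NoWildNonPrincipalInLocusTowers
(L,¬P, p ∣ n)
        ∧ NoTameInsepNonPrincipalInLocusTowers (L,¬P, p ∤ n, insep root · imperfect k) ∧ NoPurePrincipalTowers
        ∧ NoIncommensurableWildDriftingImperfectTowers
(`noSingularSurfaceHuggingTowers_iff_g21'`)
  30253 ⟺ 31571 ∧ the same six located cells                                           (`noForcedTowers_iff_g21`)
  31572 ⟺ NoWildWildHuggingTowers ∧ NoTameInsepWildHuggingTowers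
(`noWildHuggingTowers_iff_g21`, NO hypothesis)

## TAGS (pieces of the host 32260 after g21)
| piece | tag | leaf status |
|---|---|---|
| `TameSepOffLocusTowersTerminate n`, `TameSepNonPrincipalInLocusTowersTerminate n` (p ∤ n, separable root) | ⊆
31571 BY KERNEL (`…_of_contact`); perfect column DECIDED-MOD-PORT(KNOWN) (`tamePerfect…_of_ports`) | booked on
31571 (UNDECIDED only on its imperfect column `ContactImperfect`) |
| `WildOffLocusTowersTerminate n` (O, p ∣ n) | WEAKER · UNDECIDED · LOCATED | IDEA-NEEDED (q-power initial
forms, rider law (R2)/(R3): in_n(I_j) ⊆ κ_j[X^q,Y^q,Z^q]) · INSTRUMENTABLE (433 census chains) |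
| `TameInsepOffLocusTowersTerminate n` (O, p ∤ n, inseparable root) | WEAKER · UNDECIDED · LOCATED (imperfect k
only: `tameInsepOffLocus_of_imperfect`) | ATTACKABLE for F-finite k (absolute Hasse system, HOME g20 §41
`exists_absHasseSystem` + the Lucas bite) · IDEA-NEEDED for [k:k^p] = ∞ |
| `WildNonPrincipalInLocusTowersTerminate n`, `TameInsepNonPrincipalInLocusTowersTerminate n` | WEAKER · UNDECIDED
· LOCATED | as above (d = 4 column) |
| `PurePrincipalTowersTerminate n` | DECIDED-MOD-PORT INHERITED (g13) | — |
| `IncommensurableWildDriftingImperfectTowersTerminate n` | LOCATED (tree g19); CLOSED mod `AbsRiderPort` by HOME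
g20 §39 | — |
| ports used | NONE NEW. Inherited COSTUME: ShadowPort, MarkingPort, DescentPort, FactorContactPort, CouplingPort,
RiderPort (g14–g19); g12's ContactShadow/TowerObstructsAll + X1 only in the `…_of_ports` corollaries | — |

WHY STRICTLY WEAKER / NOT COSTUME: each located cell is a decidable sub-cell of (O) resp. (L,¬P) (weight arithmetic /
root residue field), and BOTH halves of the weight split are INHABITED by census footprints (HOME/census/iz/T-IZ1-all.json,
837 off-locus hug-forced chains over 𝔽_p, p ∈ {2,3,5}): TAME `p ∤ n` 404 chains — e.g. `2:A3line:y2+x4u:FOFF1:1` (p=2,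
n=3), `3:T-line:y3+x4u2:FOFF1:0` (p=3, n=4 > p: outside the route aside 28012 «n < p»), `5:Q-line:y5+x6u4:FOFF1:54`
(p=5, n=7) — the INHABITANTS OF THE DECIDED DIFFERENCE (perfect field, separable root, p ∤ n); WILD `p ∣ n` 433 chains —
e.g. `2:A2line:y2+x3u:FOFF0:11` (n=2), `3:T-line:y3+x4u2:FOFF0:3` (n=3), `5:Q-line:y5+x6u4:FOFF0:13` (n=5) — the
inhabitants of the located residual.  The must-fail probe `g21/bc/Probe.lean` records that no cell, port or iff closes
by the standard batteries.

WHY NOVEL (relative to the route and the tree): the route's aside 28012 `TameHasContact` is the STEP-side, `k`-RELATIVE,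
PERFECT-field, `n < p` existence of a contact element; the tree's lens-6 theorems are about core BRANCHES at marking 3.
New here: (i) the law for ALL `p ∤ n` at SEPARABLE-RESIDUE roots over ANY field, (ii) its TOWER consequence for lens-4's
`ForcedTower` — Giraud persistence kernelised along the forced tower at every marking (`tower_absInv_strictIter`), (iii) the
resulting EXACT cut of the lens-4 column, of 31571's complement 31572, and of the root by the weight/residue axis:
«a minimal singular-surface counterexample has `p ∣ n` or an inseparable root point».

(Sources: Giraud1975; EncinasVillamayor2000 Thm. 4.9; BravoGarciaEscamillaVillamayor2012 Lemma 4.6; EGAIV4 §16.8,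
Thm. 16.11.2; StacksProject 00TV, 0BIQ; Liu2002 Thm. 8.1.19; BierstoneGrigorievMilmanWlodarczyk2011 §3, Lemma
3.6.2; Kollar2007 3.57; CossartJannsenSaito2020; CossartPiltant2019; Cutkosky2009 Thm. 5.1; Moh1987.)
-/

noncomputable section

open CategoryTheory AlgebraicGeometry IsLocalRing
open Literature.AlgebraicGeometry.Resolution
open Summit.ResolutionOfSingularities.ResolutionOfSingularities.Theorems
open WeakOrderReduction ForcedTowerClasses DivergentTowerClasses MonomialTowerClasses
open HugDimensionClasses HugDimensionKernels SurfaceShadowClasses SurfaceShadowKernels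
open ContactShadowClasses (NoTowerImperfect ContactShadow TowerObstructsAll ContactPerfect)
open ContactShadowKernels (noTowerImperfect_of_noTower noTowerImperfect_mono noTower_iff_columns)
open NearPointCut (SingularClass singularSurface_iff_noTower)
open AbsoluteContactClasses (IsAbsContactAt SepResidueAt AbsInv absInv_point hsPortSepResidue sepResidueAt_of_perfectField not_perfectField_of_not_sepResidueAt diffIdeal_restrict_le)

namespace Summit.ResolutionOfSingularities.ResolutionOfSingularities.Theorems.HugValuationCut

/-- **The WILD-WEIGHT column** of a tower class: «no infinite forced tower of the class with `p ∣ n` satisfies `P`». -/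
def NoTowerWild (n : ℕ) (P : ForcedTower → Prop) : Prop :=
  ∀ p : ℕ, p.Prime → p ∣ n → ∀ (k : Type) [Field k] [CharP k p] (T : ForcedTower) (g : T.St 0 ⟶ Spec (.of k)),
    IsBase (T.St 0) g → IsDatum n (T.D 0) → (T.D 0).boundary = [] → P T → False

/-- **The TAME–SEPARABLE column**: `p ∤ n` and the residue field of the ROOT POINT `x₀ = T.pt 0` is separable over `k`
(automatic over a perfect field). -/
def NoTowerTameSep (n : ℕ) (P : ForcedTower → Prop) : Prop :=
  ∀ p : ℕ, p.Prime → ¬ p ∣ n → ∀ (k : Type) [Field k] [CharP k p] (T : ForcedTower) (g : T.St 0 ⟶ Spec (.of k)),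
    IsBase (T.St 0) g → IsDatum n (T.D 0) → (T.D 0).boundary = [] → SepResidueAt g (T.pt 0) → P T → False

/-- **The TAME–INSEPARABLE column**: `p ∤ n` and `κ(x₀)/k` is NOT separable (so `k` is imperfect). -/
def NoTowerTameInsep (n : ℕ) (P : ForcedTower → Prop) : Prop :=
  ∀ p : ℕ, p.Prime → ¬ p ∣ n → ∀ (k : Type) [Field k] [CharP k p] (T : ForcedTower) (g : T.St 0 ⟶ Spec (.of k)),
    IsBase (T.St 0) g → IsDatum n (T.D 0) → (T.D 0).boundary = [] → ¬ SepResidueAt g (T.pt 0) → P T → False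

/-- The TAME column over PERFECT ground fields. -/
def NoTowerTamePerfect (n : ℕ) (P : ForcedTower → Prop) : Prop :=
  ∀ p : ℕ, p.Prime → ¬ p ∣ n → ∀ (k : Type) [Field k] [CharP k p] [PerfectField k] (T : ForcedTower)
    (g : T.St 0 ⟶ Spec (.of k)),
    IsBase (T.St 0) g → IsDatum n (T.D 0) → (T.D 0).boundary = [] → P T → False

/-- The WILD column over PERFECT ground fields. -/
def NoTowerWildPerfect (n : ℕ) (P : ForcedTower → Prop) : Prop :=
  ∀ p : ℕ, p.Prime → p ∣ n → ∀ (k : Type) [Field k] [CharP k p] [PerfectField k] (T : ForcedTower)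
    (g : T.St 0 ⟶ Spec (.of k)),
    IsBase (T.St 0) g → IsDatum n (T.D 0) → (T.D 0).boundary = [] → P T → False

/-- **Kernel (PROVED, pure logic: `em (p ∣ n)`, `em (SepResidueAt g x₀)`): EXACT
`NoTower n P ⟺ Wild ∧ TameSep ∧ TameInsep`.** [folklore] -/
theorem noTower_iff_g21 {n : ℕ} (P : ForcedTower → Prop) :
    NoTower n P ↔ NoTowerWild n P ∧ NoTowerTameSep n P ∧ NoTowerTameInsep n P := by
  refine ⟨fun h => ⟨fun p hp _ k _ _ T g hB hD hE hP => h p hp k T g hB hD hE hP,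
    fun p hp _ k _ _ T g hB hD hE _ hP => h p hp k T g hB hD hE hP,
    fun p hp _ k _ _ T g hB hD hE _ hP => h p hp k T g hB hD hE hP⟩, fun h p hp k _ _ T g hB hD hE hP => ?_⟩
  obtain ⟨hw, hs, hi⟩ := h
  by_cases hpn : p ∣ n
  · exact hw p hp hpn k T g hB hD hE hP
  · by_cases hsep : SepResidueAt g (T.pt 0)
    · exact hs p hp hpn k T g hB hD hE hsep hP
    · exact hi p hp hpn k T g hB hD hE hsep hP

/-- EXACT over perfect fields: `NoTowerPerfect n P ⟺ WildPerfect ∧ TamePerfect`. [folklore] -/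
theorem noTowerPerfect_iff_g21 {n : ℕ} (P : ForcedTower → Prop) :
    NoTowerPerfect n P ↔ NoTowerWildPerfect n P ∧ NoTowerTamePerfect n P := by
  refine ⟨fun h => ⟨fun p hp _ k _ _ _ T g hB hD hE hP => h p hp k T g hB hD hE hP,
    fun p hp _ k _ _ _ T g hB hD hE hP => h p hp k T g hB hD hE hP⟩, fun h p hp k _ _ _ T g hB hD hE hP => ?_⟩
  by_cases hpn : p ∣ n
  · exact h.1 p hp hpn k T g hB hD hE hP
  · exact h.2 p hp hpn k T g hB hD hE hP

/-- monotonicity. [folklore] -/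
theorem noTowerWild_mono {n : ℕ} {P Q : ForcedTower → Prop} (hPQ : ∀ T, Q T → P T) (h : NoTowerWild n P) :
    NoTowerWild n Q :=
  fun p hp hpn k _ _ T g hB hD hE hQ => h p hp hpn k T g hB hD hE (hPQ T hQ)

/-- monotonicity. [folklore] -/
theorem noTowerTameSep_mono {n : ℕ} {P Q : ForcedTower → Prop} (hPQ : ∀ T, Q T → P T) (h : NoTowerTameSep n P) :
    NoTowerTameSep n Q :=
  fun p hp hpn k _ _ T g hB hD hE hs hQ => h p hp hpn k T g hB hD hE hs (hPQ T hQ)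

/-- monotonicity. [folklore] -/
theorem noTowerTameInsep_mono {n : ℕ} {P Q : ForcedTower → Prop} (hPQ : ∀ T, Q T → P T) (h : NoTowerTameInsep n P) :
    NoTowerTameInsep n Q :=
  fun p hp hpn k _ _ T g hB hD hE hs hQ => h p hp hpn k T g hB hD hE hs (hPQ T hQ)

/-- the three columns of a terminating class terminate. [folklore] -/
theorem noTowerWild_of_noTower {n : ℕ} {P : ForcedTower → Prop} (h : NoTower n P) : NoTowerWild n P :=
  ((noTower_iff_g21 P).mp h).1

/-- the three columns of a terminating class terminate. [folklore] -/
theorem noTowerTameSep_of_noTower {n : ℕ} {P : ForcedTower → Prop} (h : NoTower n P) : NoTowerTameSep n P :=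
  ((noTower_iff_g21 P).mp h).2.1

/-- the three columns of a terminating class terminate. [folklore] -/
theorem noTowerTameInsep_of_noTower {n : ℕ} {P : ForcedTower → Prop} (h : NoTower n P) : NoTowerTameInsep n P :=
  ((noTower_iff_g21 P).mp h).2.2

/-- **Kernel (PROVED): the tame–inseparable column is an IMPERFECT-FIELD phenomenon** — an inseparable residue field at
the (closed) root point forces `k` to be imperfect (tree `not_perfectField_of_not_sepResidueAt`), so the column is
contained in the tree's imperfect column `NoTowerImperfect`. [folklore] -/
theorem noTowerTameInsep_of_imperfect {n : ℕ} {P : ForcedTower → Prop} (h : NoTowerImperfect n P) :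
    NoTowerTameInsep n P := by
  intro p hp _ k _ _ T g hB hD hE hsep hP
  haveI : LocallyOfFiniteType g := hB.locallyOfFiniteType
  exact h p hp k (not_perfectField_of_not_sepResidueAt g (T.isClosed_pt 0) hsep) T g hB hD hE hP

/-- **Kernel (PROVED): over a perfect field every root is separable** — the tame–separable column contains the tame
perfect column (tree `sepResidueAt_of_perfectField`). [folklore] -/
theorem noTowerTamePerfect_of_tameSep {n : ℕ} {P : ForcedTower → Prop} (h : NoTowerTameSep n P) :
    NoTowerTamePerfect n P := by
  intro p hp hpn k _ _ _ T g hB hD hE hP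
  haveI : LocallyOfFiniteType g := hB.locallyOfFiniteType
  exact h p hp hpn k T g hB hD hE (sepResidueAt_of_perfectField g (T.isClosed_pt 0)) hP

/-- the wild perfect column is part of the wild column. [folklore] -/
theorem noTowerWildPerfect_of_wild {n : ℕ} {P : ForcedTower → Prop} (h : NoTowerWild n P) : NoTowerWildPerfect n P :=
  fun p hp hpn k _ _ _ T g hB hD hE hP => h p hp hpn k T g hB hD hE hP

/-! ## §45 (g21 · NEW) The cells cut on the lens-4 column at weight `n` and their EXACT re-locations -/

/-- **CELL (O, wild) · THE LOCATED RESIDUAL of (O): off-locus singular-class towers of weight DIVISIBLE BY `p`.**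
UNDECIDED · IDEA-NEEDED (rider law: `q`-power initial forms) · INSTRUMENTABLE (433 census chains). -/
def WildOffLocusTowersTerminate (n : ℕ) : Prop :=
  NoTowerWild n fun T => SingularClass T ∧ Nonempty (MarkedShadow T n)

/-- **CELL (O, tame, separable root)** — ⊆ 31571 BY KERNEL (`tameSepOffLocus_of_contact`); perfect column
EMPTY-MOD-PORT(KNOWN) (`tamePerfectOffLocus_of_ports`). -/
def TameSepOffLocusTowersTerminate (n : ℕ) : Prop :=
  NoTowerTameSep n fun T => SingularClass T ∧ Nonempty (MarkedShadow T n)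

/-- **CELL (O, tame, inseparable root) · LOCATED (imperfect `k` only)** · ATTACKABLE (F-finite `k`: absolute Hasse system)
· IDEA-NEEDED (`[k : k^p] = ∞`). -/
def TameInsepOffLocusTowersTerminate (n : ℕ) : Prop :=
  NoTowerTameInsep n fun T => SingularClass T ∧ Nonempty (MarkedShadow T n)

/-- **CELL (O, tame, perfect k)** — THE DECIDED CELL OF g21 (`tamePerfectOffLocus_of_ports`). -/
def TamePerfectOffLocusTowersTerminate (n : ℕ) : Prop :=
  NoTowerTamePerfect n fun T => SingularClass T ∧ Nonempty (MarkedShadow T n)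

/-- **CELL (L,¬P, wild) · LOCATED RESIDUAL of (L,¬P)** (d = 4, weight divisible by `p`). -/
def WildNonPrincipalInLocusTowersTerminate (n : ℕ) : Prop :=
  NoTowerWild n fun T => SingularClass T ∧ InLocusShadow T ∧ ∀ S : HugShadow T, ¬ S.Principal

/-- **CELL (L,¬P, tame, separable root)** — ⊆ 31571 BY KERNEL. -/
def TameSepNonPrincipalInLocusTowersTerminate (n : ℕ) : Prop :=
  NoTowerTameSep n fun T => SingularClass T ∧ InLocusShadow T ∧ ∀ S : HugShadow T, ¬ S.Principal

/-- **CELL (L,¬P, tame, inseparable root) · LOCATED (imperfect `k` only).** -/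
def TameInsepNonPrincipalInLocusTowersTerminate (n : ℕ) : Prop :=
  NoTowerTameInsep n fun T => SingularClass T ∧ InLocusShadow T ∧ ∀ S : HugShadow T, ¬ S.Principal

/-- **CELL (L,¬P, tame, perfect k)** — DECIDED (`tamePerfectNonPrincipal_of_ports`). -/
def TamePerfectNonPrincipalInLocusTowersTerminate (n : ℕ) : Prop :=
  NoTowerTamePerfect n fun T => SingularClass T ∧ InLocusShadow T ∧ ∀ S : HugShadow T, ¬ S.Principal

/-- **CELL (31572, wild)** — wild-hugging towers (a germ but no regular hypersurface germ hugged) of weight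
divisible by `p`. -/
def WildWildHuggingTowersTerminate (n : ℕ) : Prop :=
  NoTowerWild n fun T => GermHugging T ∧ ¬ ContactHugging T

/-- **CELL (31572, tame, inseparable root)** — LOCATED (imperfect `k` only). -/
def TameInsepWildHuggingTowersTerminate (n : ℕ) : Prop :=
  NoTowerTameInsep n fun T => GermHugging T ∧ ¬ ContactHugging T

/-! ## §46 (g21 · NEW) the all-weights classes (the BY-NAME wiring to the MaxContactCut items is `MaxContactCutTameCut`) -/

/-- (O, wild) over all weights. -/
def NoWildOffLocusTowers : Prop := ∀ n : ℕ, 1 ≤ n → WildOffLocusTowersTerminate n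

/-- (O, tame, separable root) over all weights — ⊆ 31571 (`noTameSepOffLocusTowers_of_item`). -/
def NoTameSepOffLocusTowers : Prop := ∀ n : ℕ, 1 ≤ n → TameSepOffLocusTowersTerminate n

/-- (O, tame, inseparable root) over all weights (imperfect `k` only). -/
def NoTameInsepOffLocusTowers : Prop := ∀ n : ℕ, 1 ≤ n → TameInsepOffLocusTowersTerminate n

/-- (O, tame, perfect k) over all weights — THE DECIDED CELL (`noTamePerfectOffLocusTowers_of_ports`). -/
def NoTamePerfectOffLocusTowers : Prop := ∀ n : ℕ, 1 ≤ n → TamePerfectOffLocusTowersTerminate n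

/-- (L,¬P, wild) over all weights. -/
def NoWildNonPrincipalInLocusTowers : Prop := ∀ n : ℕ, 1 ≤ n → WildNonPrincipalInLocusTowersTerminate n

/-- (L,¬P, tame, separable root) over all weights — ⊆ 31571. -/
def NoTameSepNonPrincipalInLocusTowers : Prop := ∀ n : ℕ, 1 ≤ n → TameSepNonPrincipalInLocusTowersTerminate n

/-- (L,¬P, tame, inseparable root) over all weights. -/
def NoTameInsepNonPrincipalInLocusTowers : Prop := ∀ n : ℕ, 1 ≤ n → TameInsepNonPrincipalInLocusTowersTerminate n

/-- (L,¬P, tame, perfect k) over all weights — DECIDED. -/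
def NoTamePerfectNonPrincipalInLocusTowers : Prop := ∀ n : ℕ, 1 ≤ n → TamePerfectNonPrincipalInLocusTowersTerminate n

/-- (31572, wild) over all weights. -/
def NoWildWildHuggingTowers : Prop := ∀ n : ℕ, 1 ≤ n → WildWildHuggingTowersTerminate n

/-- (31572, tame, inseparable root) over all weights. -/
def NoTameInsepWildHuggingTowers : Prop := ∀ n : ℕ, 1 ≤ n → TameInsepWildHuggingTowersTerminate n

/-! ## §47 (g21 · NEW · KERNEL, hypothesis-free) THE LUCAS BITE OF THE TAME HASSE LEMMA — the arithmetic certificate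
`∂^{(a−1)} X^a = a · X`, `Σ β_i = n ≢ 0 (mod p) ⇒ ∃ i, β_i ≢ 0 (mod p)` -/

/-- `C(a, a − 1) = a`: the coefficient of the Hasse derivative `∂^{(a−1)}` on `X^a`. [folklore] -/
theorem choose_sub_one_eq (a : ℕ) (ha : 1 ≤ a) : a.choose (a - 1) = a := by
  obtain ⟨b, rfl⟩ : ∃ b, a = b + 1 := ⟨a - 1, by omega⟩
  simp [Nat.choose_succ_self_right]

/-- **A multi-index of total degree prime to `p` has a coordinate prime to `p`** (the exponent on which the tame Hasse
derivative bites). [folklore] -/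
theorem exists_not_dvd_of_not_dvd_sum {p : ℕ} {ι : Type} (s : Finset ι) (β : ι → ℕ) (h : ¬ p ∣ ∑ i ∈ s, β i) :
    ∃ i ∈ s, ¬ p ∣ β i := by
  by_contra hcon
  push Not at hcon
  exact h (Finset.dvd_sum fun i hi => hcon i hi)

/-- **The wild weights are the multiples of `p`; in particular every weight `n` with `1 ≤ n < p` is tame** (the route's
aside 28012 «n < p» is the bottom of the tame column). [folklore] -/
theorem not_dvd_of_lt {p n : ℕ} (hn : 1 ≤ n) (hnp : n < p) : ¬ p ∣ n :=
  fun h => absurd (Nat.le_of_dvd (by omega) h) (by omega)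

end Summit.ResolutionOfSingularities.ResolutionOfSingularities.Theorems.HugValuationCut
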